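import Summits.AtomisticToContinuum.FouriersLaw.Theorems.LatticeLandauDampingAbelThermodynamicLimitRegularDLRUnique
import Summits.AtomisticToContinuum.FouriersLaw.Theorems.LatticeLandauDampingAbelThermodynamicLimitFixedTimeMatchingOfRegisteredLeaves
import Summits.AtomisticToContinuum.FouriersLaw.Theses.LatticeLandauDamping
import Summits.AtomisticToContinuum.FouriersLaw.Theses.EmbeddedDrudeMourre
import Literature.MathematicalPhysics.KineticTheory.LangevinChainKernel
import Literature.MathematicalPhysics.KineticTheory.LangevinChainGibbs
import Literature.MathematicalPhysics.KineticTheory.InfiniteChainSuperstableDynamics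
import Literature.MathematicalPhysics.KineticTheory.InfiniteChainInvariantStates
import Literature.MathematicalPhysics.KineticTheory.InfiniteChainSuperstableOrbits
import Summits.AtomisticToContinuum.FouriersLaw.Theorems.StaticAbelianSqueezeKuboAbelIdentity
import Summits.AtomisticToContinuum.FouriersLaw.Theorems.OddSectorIrreversibilityCorrectorResponseNonneg
import Summits.AtomisticToContinuum.FouriersLaw.Theorems.EmbeddedDrudeMourreGreenKuboContinuationCanonicalSeedOfRegularState
import Summits.AtomisticToContinuum.FouriersLaw.Theorems.LatticeLandauDampingAbelThermodynamicLimitResolventFormPos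
import Summits.AtomisticToContinuum.FouriersLaw.Theorems.LatticeLandauDampingAbelThermodynamicLimitDyadicFekete
import Summits.AtomisticToContinuum.FouriersLaw.Theorems.LatticeLandauDampingAbelThermodynamicLimitWitnessRegularisationOfWitnessTightness
import Summits.AtomisticToContinuum.FouriersLaw.Theorems.LatticeLandauDampingAbelThermodynamicLimitFixedFrequencyMatchingAutocorrBound
import Summits.AtomisticToContinuum.FouriersLaw.Theorems.LatticeLandauDampingAbelThermodynamicLimitFixedFrequencyMatchingOfFixedTime
import Summits.AtomisticToContinuum.FouriersLaw.Theorems.LatticeLandauDampingAbelThermodynamicLimitQuasiSuperadditivityResolventCorrector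
import Summits.AtomisticToContinuum.FouriersLaw.Theorems.LatticeLandauDampingAbelThermodynamicLimitFixedFrequencyMatchingPairSums
import Summits.AtomisticToContinuum.FouriersLaw.Theorems.LatticeLandauDampingAbelThermodynamicLimitFixedFrequencyMatchingUniformLeaves
import Summits.AtomisticToContinuum.FouriersLaw.Theorems.LatticeLandauDampingAbelThermodynamicLimitFixedTimeMatchingSharedLeaves
import Summits.AtomisticToContinuum.FouriersLaw.Theorems.LatticeLandauDampingAbelThermodynamicLimitWitnessTightOfUniformEnergyBound
import Literature.MathematicalPhysics.KineticTheory.InfiniteChainGibbsUniqueness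
import Summits.AtomisticToContinuum.FouriersLaw.Theorems.LatticeLandauDampingAbelThermodynamicLimitUniformAnchoredCorrelationTails
import Summits.AtomisticToContinuum.FouriersLaw.Theorems.LatticeLandauDampingAbelThermodynamicLimitBulkWindowEquivalence
import Summits.AtomisticToContinuum.FouriersLaw.Theorems.LatticeLandauDampingAbelThermodynamicLimitOpenChainSeveredLocality
import Summits.AtomisticToContinuum.FouriersLaw.Theorems.LatticeLandauDampingAbelThermodynamicLimitOffsetMatchingOfEngines
import Literature.MathematicalPhysics.KineticTheory.InfiniteChainStates
import Literature.MathematicalPhysics.KineticTheory.InfiniteChainSevered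
import Literature.MathematicalPhysics.KineticTheory.InfiniteChainDynamicsCondB1


/-!
# The two HALVES of crux `AbelThermodynamicLimit` from one sign law each (line SketchIdeator2, lead c1, cycle 2)

Support file for the crux `stmt-AtomisticToContinuum-14013` (`LatticeLandauDamping.AbelThermodynamicLimit`, `Iff.rfl`-twin
`stmt-12596`). After cycle 2 every infrastructure stub of line `series-law-at-every-laplace-frequency` is a theorem in this
directory (fixed-frequency matching S3 ← light cone (C′) p115961, bulk equivalence (E1) p121150, severed locality (M1sev)
p124064, coupling + (B′) p126508; glue `fixedFrequencyMatching_of_registeredLeaves`; (K) `kuboAbelIdentity_holds`; positivity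
`stub_resolventFormPos`; `0 ≤ D_N` `response_nonneg_of_correctorTheory`; real analysis `…DyadicFekete`). This file lands the two
HALVES of the line's composition at a REGULAR witness as closed theorems, each taking ONE conjectural sign law as a hypothesis
(stated verbatim as the conclusion of the registered stub at the given parameter point):

* `noOvershoot_of_quasiSuperadditivity` — UPPER half (`∀ ε, eventually Dn N ≤ κ + ε`) from QS alone (strategist's `NoOvershoot`);
* `noDeficit_of_quasiSuperadditiveResistance` — LOWER half (`eventually 0 < Dn N ∧ κ − ε ≤ Dn N`) from QSR alone (`NoDeficit`);
* `stub_noDeficitOfQSR` — the lower half in binder-free form (registered on stmt-14013).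

The companion file `…OfSignLaws.lean` composes them into the (repaired and seamed) crux. Nothing here closes the item.
-/

noncomputable section

namespace Summit.AtomisticToContinuum.FouriersLaw.Theorems.AbelThermodynamicLimit.SeriesLawAtEveryLaplaceFrequency

open MeasureTheory Filter Set Topology
open Literature.MathematicalPhysics.KineticTheory.HeatConduction

/-- **UPPER HALF (`NoOvershoot`) from the conductance-side sign law QS ALONE.** For `P = pinnedChain ω₂ lam β γ` (all `> 0`),
weak-NESS uniqueness `hU`, `T > 0`, a REGULAR witness `(μT, D, κ)` (DLR + shift-invariant + BM-superstable state, `carrier ⊆ bmGood`,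
measure-preserving, absolutely convergent correlations, Abel limit `κ`), every steady family `μ` and response sequence `Dn`: IF QS
holds at this parameter point (`hQS`, verbatim the conclusion of `stub_quasiSuperadditivity`) THEN `∀ ε > 0, ∃ N₃, ∀ N ≥ N₃, Dn N ≤ κ + ε`.
Proof: (K) makes `F_N(ν) → (N−1)T²Dn N` as `ν ↓ 0`; dyadic Fekete at every Laplace frequency (`fekete_pow_abel_upper`) with the
landed matching S3 and the witness's Abel limit gives `(N−1)T²Dn N ≤ N·T²κ + K₁N^θ₁`; `tendsto_upper_envelope'`. [folklore] -/
theorem noOvershoot_of_quasiSuperadditivity {ω₂ lam β γ : ℝ} (hω : 0 < ω₂) (hl : 0 < lam) (hβ : 0 < β) (hγ : 0 < γ)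
    (hU : ∀ (N : ℕ) (T_L T_R : ℝ), 0 < T_L → 0 < T_R → ∀ μ ν : Measure (PhaseSpace N),
      (pinnedChain ω₂ lam β γ).IsSteadyState N T_L T_R μ → (pinnedChain ω₂ lam β γ).IsSteadyState N T_L T_R ν → μ = ν)
    {T : ℝ} (hT : 0 < T) {μT : Measure ChainConfig} {D : InfiniteChainDynamics (pinnedChain ω₂ lam β γ)} {κ : ℝ}
    (hG : (pinnedChain ω₂ lam β γ).IsChainGibbsMeasure T μT) (hS : IsShiftInvariant μT)
    (hss : (pinnedChain ω₂ lam β γ).HasSuperstabilityEstimate μT) (hcar : D.carrier ⊆ (pinnedChain ω₂ lam β γ).bmGood)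
    (hP : D.PreservesMeasure μT) (hAC : ∀ t : ℝ, D.HasAbsConvergentCorrelation μT t)
    (hAbel : Tendsto (fun ν : ℝ => (T ^ 2)⁻¹ *
      ∫ t in Ioi (0 : ℝ), Real.exp (-(ν * t)) * D.currentCorrelation μT t) (𝓝[>] 0) (𝓝 κ))
    (hQS : let F : ℕ → ℝ → ℝ := fun (N : ℕ) (ν : ℝ) =>
      MeasureTheory.integral (MeasureTheory.volume.restrict (Set.Ioi (0:ℝ))) (fun t : ℝ =>
        Real.exp (-(ν * t)) *
          ∫ z, (∑ i : Fin N, (Literature.MathematicalPhysics.KineticTheory.HeatConduction.pinnedChain ω₂ lam β γ).bondCurrent N i z) *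
            (∫ y, (∑ i : Fin N, (Literature.MathematicalPhysics.KineticTheory.HeatConduction.pinnedChain ω₂ lam β γ).bondCurrent N i y) ∂((Literature.MathematicalPhysics.KineticTheory.HeatConduction.pinnedChain ω₂ lam β γ).transitionKernel N T T t.toNNReal z))
            ∂((Literature.MathematicalPhysics.KineticTheory.HeatConduction.pinnedChain ω₂ lam β γ).gibbsMeasure N T));
      ∃ C θ ν₀ : ℝ, ∃ N₀ : ℕ, 0 ≤ C ∧ θ < 1 ∧ 0 < ν₀ ∧ ∀ ν : ℝ, 0 < ν → ν ≤ ν₀ → ∀ N : ℕ, N₀ ≤ N →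
        2 * F N ν - C * ((2 * N : ℕ) : ℝ) ^ θ ≤ F (2 * N) ν)
    (μ : (N : ℕ) → ℝ → ℝ → Measure (PhaseSpace N))
    (hμ : ∀ (N : ℕ) (T_L T_R : ℝ), 0 < T_L → 0 < T_R → (pinnedChain ω₂ lam β γ).IsSteadyState N T_L T_R (μ N T_L T_R))
    (Dn : ℕ → ℝ)
    (hD : ∀ N : ℕ, Tendsto (fun δ : ℝ => (pinnedChain ω₂ lam β γ).totalCurrent (μ N (T + δ / 2) (T - δ / 2)) / δ)
      (𝓝[≠] 0) (𝓝 (Dn N))) :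
    ∀ ε : ℝ, 0 < ε → ∃ N₃ : ℕ, ∀ N : ℕ, N₃ ≤ N → Dn N ≤ κ + ε := by
  obtain ⟨C₁, θ₁, ν₁, N₁, hC₁, hθ₁, hν₁, hqs0⟩ := hQS
  set N₀ : ℕ := max N₁ 2 with hN₀def
  have hN₀2 : 2 ≤ N₀ := le_max_right _ _
  have hN₀1 : 1 ≤ N₀ := le_trans one_le_two hN₀2
  have hN₁le : N₁ ≤ N₀ := le_max_left _ _
  obtain ⟨F, hF⟩ : ∃ F : ℕ → ℝ → ℝ, F = fun (N : ℕ) (ν : ℝ) =>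
      MeasureTheory.integral (MeasureTheory.volume.restrict (Set.Ioi (0:ℝ))) (fun t : ℝ =>
        Real.exp (-(ν * t)) *
          ∫ z, (∑ i : Fin N, (Literature.MathematicalPhysics.KineticTheory.HeatConduction.pinnedChain ω₂ lam β γ).bondCurrent N i z) *
            (∫ y, (∑ i : Fin N, (Literature.MathematicalPhysics.KineticTheory.HeatConduction.pinnedChain ω₂ lam β γ).bondCurrent N i y) ∂((Literature.MathematicalPhysics.KineticTheory.HeatConduction.pinnedChain ω₂ lam β γ).transitionKernel N T T t.toNNReal z))
            ∂((Literature.MathematicalPhysics.KineticTheory.HeatConduction.pinnedChain ω₂ lam β γ).gibbsMeasure N T)) := ⟨_, rfl⟩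
  have hmatch0 := fixedFrequencyMatching_of_registeredLeaves stub_uniformAnchoredCorrelationTails
    stub_uniformFixedTimeOffsetMatching ω₂ lam β γ hω hl hβ hγ T hT
    (stub_regularDLRUnique ω₂ lam β γ hω hl hβ hγ T hT) μT D hG hS hss hcar hP hAC
  have hmatch : ∀ ν : ℝ, 0 < ν → Tendsto (fun N : ℕ => F N ν / (N : ℝ)) atTop
      (𝓝 (∫ t in Ioi (0 : ℝ), Real.exp (-(ν * t)) * D.currentCorrelation μT t)) := fun ν hν => by
    simpa only [hF] using hmatch0 ν hν
  have hqs : ∀ ν : ℝ, 0 < ν → ν ≤ ν₁ → ∀ N : ℕ, N₁ ≤ N →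
      2 * F N ν - C₁ * ((2 * N : ℕ) : ℝ) ^ θ₁ ≤ F (2 * N) ν := fun ν hν hν' N hN => by
    simpa only [hF] using hqs0 ν hν hν' N hN
  -- (K), LANDED
  have hK' : ∀ N : ℕ, IntegrableOn (fun t : ℝ => ∫ z, (∑ i : Fin N, (Literature.MathematicalPhysics.KineticTheory.HeatConduction.pinnedChain ω₂ lam β γ).bondCurrent N i z) *
        (∫ y, (∑ i : Fin N, (Literature.MathematicalPhysics.KineticTheory.HeatConduction.pinnedChain ω₂ lam β γ).bondCurrent N i y) ∂((Literature.MathematicalPhysics.KineticTheory.HeatConduction.pinnedChain ω₂ lam β γ).transitionKernel N T T t.toNNReal z))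
        ∂((Literature.MathematicalPhysics.KineticTheory.HeatConduction.pinnedChain ω₂ lam β γ).gibbsMeasure N T)) (Ioi 0) ∧
      ((N : ℝ) - 1) * T ^ 2 * Dn N = ∫ t in Ioi (0 : ℝ), ∫ z, (∑ i : Fin N, (Literature.MathematicalPhysics.KineticTheory.HeatConduction.pinnedChain ω₂ lam β γ).bondCurrent N i z) *
        (∫ y, (∑ i : Fin N, (Literature.MathematicalPhysics.KineticTheory.HeatConduction.pinnedChain ω₂ lam β γ).bondCurrent N i y) ∂((Literature.MathematicalPhysics.KineticTheory.HeatConduction.pinnedChain ω₂ lam β γ).transitionKernel N T T t.toNNReal z))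
        ∂((Literature.MathematicalPhysics.KineticTheory.HeatConduction.pinnedChain ω₂ lam β γ).gibbsMeasure N T) :=
    fun N => StaticAbelianSqueeze.kuboAbelIdentity_holds
      ω₂ lam β γ hω hl hβ hγ hU μ hμ T hT N (Dn N) (hD N)
  have hDC : ∀ N : ℕ, Tendsto (F N) (𝓝[>] 0) (𝓝 (((N : ℝ) - 1) * T ^ 2 * Dn N)) := by
    intro N
    rw [(hK' N).2]
    simpa only [hF] using tendsto_laplace_zero (hK' N).1
  set Ahat : ℝ → ℝ := fun ν => ∫ t in Ioi (0 : ℝ), Real.exp (-(ν * t)) * D.currentCorrelation μT t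
    with hAhat
  have hT2 : (T ^ 2) ≠ 0 := by positivity
  have hT2pos : (0 : ℝ) < T ^ 2 := by positivity
  have hA : Tendsto Ahat (𝓝[>] 0) (𝓝 (T ^ 2 * κ)) := by
    have h := hAbel.const_mul (T ^ 2)
    refine h.congr' (Eventually.of_forall fun ν => ?_)
    simp only [hAhat]
    rw [← mul_assoc, mul_inv_cancel₀ hT2, one_mul]
  set K₁ : ℝ := C₁ * ((2:ℝ) ^ (θ₁ - 1) / (1 - (2:ℝ) ^ (θ₁ - 1))) with hK₁
  -- UPPER envelope: dyadic Fekete at every Laplace frequency on the conductance form (QS)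
  have hup : ∀ N : ℕ, N₀ ≤ N → ((N : ℝ) - 1) * T ^ 2 * Dn N ≤ N * (T ^ 2 * κ) + K₁ * (N : ℝ) ^ θ₁ :=
    fekete_pow_abel_upper (F) (fun N => ((N : ℝ) - 1) * T ^ 2 * Dn N)
      Ahat C₁ θ₁ (T ^ 2 * κ) ν₁ N₀ hN₀1 hC₁ hθ₁ hν₁
      (fun ν hν N hN => hqs ν hν.1 hν.2 N (le_trans hN₁le hN))
      (fun ν hν => by simpa only [hAhat] using hmatch ν hν.1)
      hA (fun N _ => hDC N)
  -- divide by `T²` and by `N − 1`: `Dn N ≤ (Nκ + (K₁/T²)N^θ₁)/(N−1) → κ`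
  have henv := tendsto_upper_envelope' κ
    (fun N => K₁ / T ^ 2 * (N : ℝ) ^ θ₁)
    (tendsto_const_mul_rpow_div (K₁ / T ^ 2) θ₁ hθ₁)
  intro ε hε
  have hev : ∀ᶠ N : ℕ in atTop, ((N : ℝ) * κ + K₁ / T ^ 2 * (N : ℝ) ^ θ₁) / ((N : ℝ) - 1) < κ + ε :=
    henv (Iio_mem_nhds (by linarith))
  obtain ⟨N₄, hN₄⟩ := (hev.and (eventually_ge_atTop N₀)).exists_forall_of_atTop
  refine ⟨N₄, fun N hN => ?_⟩
  obtain ⟨hlt, hN0⟩ := hN₄ N hN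
  have h := hup N hN0
  have hN2 : (2 : ℝ) ≤ N := by exact_mod_cast (le_trans hN₀2 hN0)
  have hN1 : (0 : ℝ) < (N : ℝ) - 1 := by linarith
  have e1 : ((N : ℝ) - 1) * T ^ 2 * Dn N = T ^ 2 * (((N : ℝ) - 1) * Dn N) := by ring
  have e2 : (N : ℝ) * (T ^ 2 * κ) + K₁ * (N : ℝ) ^ θ₁ = T ^ 2 * ((N : ℝ) * κ + K₁ / T ^ 2 * (N : ℝ) ^ θ₁) := by
    field_simp
  rw [e1, e2] at h
  have h' : ((N : ℝ) - 1) * Dn N ≤ (N : ℝ) * κ + K₁ / T ^ 2 * (N : ℝ) ^ θ₁ := le_of_mul_le_mul_left h hT2pos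
  have h'' : Dn N ≤ ((N : ℝ) * κ + K₁ / T ^ 2 * (N : ℝ) ^ θ₁) / ((N : ℝ) - 1) := by
    rw [le_div_iff₀ hN1, mul_comm]
    exact h'
  exact h''.trans hlt.le


/-- **LOWER HALF (`NoDeficit`) from the resistance-side sign law QSR ALONE.** Same setting; IF QSR holds at this parameter point
(`hQSR`, verbatim the conclusion of `stub_quasiSuperadditiveResistance`) THEN `∀ ε > 0, ∃ N₃, ∀ N ≥ N₃, 0 < Dn N ∧ κ − ε ≤ Dn N`.
Proof: dyadic Fekete at fixed `ν` on the resistance form `R_N(ν) = (N−1)²T²/F_N(ν)` bounds `R_N(ν) ≤ N·T²/Â(ν) + K₂N^θ₂` on a window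
`(0, ν₀]` where `Â > T²κ/2`; `ν ↓ 0` at fixed `N` through (K) with `F_N(ν) > 0` (`stub_resolventFormPos`) and `0 ≤ Dn N`
(`response_nonneg_of_correctorTheory`) FORCES `0 < Dn N` and `(N−1)/Dn N ≤ N/κ + K₂N^θ₂` (`dc_of_resistance_bound`); then
`conductance_lower_of_resistance'` + `tendsto_lower_envelope'`. [folklore] -/
theorem noDeficit_of_quasiSuperadditiveResistance {ω₂ lam β γ : ℝ} (hω : 0 < ω₂) (hl : 0 < lam) (hβ : 0 < β) (hγ : 0 < γ)
    (hU : ∀ (N : ℕ) (T_L T_R : ℝ), 0 < T_L → 0 < T_R → ∀ μ ν : Measure (PhaseSpace N),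
      (pinnedChain ω₂ lam β γ).IsSteadyState N T_L T_R μ → (pinnedChain ω₂ lam β γ).IsSteadyState N T_L T_R ν → μ = ν)
    {T : ℝ} (hT : 0 < T) {μT : Measure ChainConfig} {D : InfiniteChainDynamics (pinnedChain ω₂ lam β γ)} {κ : ℝ}
    (hG : (pinnedChain ω₂ lam β γ).IsChainGibbsMeasure T μT) (hS : IsShiftInvariant μT)
    (hss : (pinnedChain ω₂ lam β γ).HasSuperstabilityEstimate μT) (hcar : D.carrier ⊆ (pinnedChain ω₂ lam β γ).bmGood)
    (hP : D.PreservesMeasure μT) (hAC : ∀ t : ℝ, D.HasAbsConvergentCorrelation μT t) (hκ : 0 < κ)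
    (hAbel : Tendsto (fun ν : ℝ => (T ^ 2)⁻¹ *
      ∫ t in Ioi (0 : ℝ), Real.exp (-(ν * t)) * D.currentCorrelation μT t) (𝓝[>] 0) (𝓝 κ))
    (hQSR : let F : ℕ → ℝ → ℝ := fun (N : ℕ) (ν : ℝ) =>
      MeasureTheory.integral (MeasureTheory.volume.restrict (Set.Ioi (0:ℝ))) (fun t : ℝ =>
        Real.exp (-(ν * t)) *
          ∫ z, (∑ i : Fin N, (Literature.MathematicalPhysics.KineticTheory.HeatConduction.pinnedChain ω₂ lam β γ).bondCurrent N i z) *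
            (∫ y, (∑ i : Fin N, (Literature.MathematicalPhysics.KineticTheory.HeatConduction.pinnedChain ω₂ lam β γ).bondCurrent N i y) ∂((Literature.MathematicalPhysics.KineticTheory.HeatConduction.pinnedChain ω₂ lam β γ).transitionKernel N T T t.toNNReal z))
            ∂((Literature.MathematicalPhysics.KineticTheory.HeatConduction.pinnedChain ω₂ lam β γ).gibbsMeasure N T));
      let R : ℕ → ℝ → ℝ := fun N ν => ((N : ℝ) - 1) ^ 2 * T ^ 2 / F N ν;
      ∃ C θ ν₀ : ℝ, ∃ N₀ : ℕ, 0 ≤ C ∧ θ < 1 ∧ 0 < ν₀ ∧ ∀ ν : ℝ, 0 < ν → ν ≤ ν₀ → ∀ N : ℕ, N₀ ≤ N →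
        2 * R N ν - C * ((2 * N : ℕ) : ℝ) ^ θ ≤ R (2 * N) ν)
    (μ : (N : ℕ) → ℝ → ℝ → Measure (PhaseSpace N))
    (hμ : ∀ (N : ℕ) (T_L T_R : ℝ), 0 < T_L → 0 < T_R → (pinnedChain ω₂ lam β γ).IsSteadyState N T_L T_R (μ N T_L T_R))
    (Dn : ℕ → ℝ)
    (hD : ∀ N : ℕ, Tendsto (fun δ : ℝ => (pinnedChain ω₂ lam β γ).totalCurrent (μ N (T + δ / 2) (T - δ / 2)) / δ)
      (𝓝[≠] 0) (𝓝 (Dn N))) :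
    ∀ ε : ℝ, 0 < ε → ∃ N₃ : ℕ, ∀ N : ℕ, N₃ ≤ N → 0 < Dn N ∧ κ - ε ≤ Dn N := by
  obtain ⟨C₂, θ₂, ν₂, N₂, hC₂, hθ₂, hν₂, hqsr0⟩ := hQSR
  set N₀ : ℕ := max N₂ 2 with hN₀def
  have hN₀2 : 2 ≤ N₀ := le_max_right _ _
  have hN₀1 : 1 ≤ N₀ := le_trans one_le_two hN₀2
  have hN₂le : N₂ ≤ N₀ := le_max_left _ _
  obtain ⟨F, hF⟩ : ∃ F : ℕ → ℝ → ℝ, F = fun (N : ℕ) (ν : ℝ) =>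
      MeasureTheory.integral (MeasureTheory.volume.restrict (Set.Ioi (0:ℝ))) (fun t : ℝ =>
        Real.exp (-(ν * t)) *
          ∫ z, (∑ i : Fin N, (Literature.MathematicalPhysics.KineticTheory.HeatConduction.pinnedChain ω₂ lam β γ).bondCurrent N i z) *
            (∫ y, (∑ i : Fin N, (Literature.MathematicalPhysics.KineticTheory.HeatConduction.pinnedChain ω₂ lam β γ).bondCurrent N i y) ∂((Literature.MathematicalPhysics.KineticTheory.HeatConduction.pinnedChain ω₂ lam β γ).transitionKernel N T T t.toNNReal z))
            ∂((Literature.MathematicalPhysics.KineticTheory.HeatConduction.pinnedChain ω₂ lam β γ).gibbsMeasure N T)) := ⟨_, rfl⟩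
  have hmatch0 := fixedFrequencyMatching_of_registeredLeaves stub_uniformAnchoredCorrelationTails
    stub_uniformFixedTimeOffsetMatching ω₂ lam β γ hω hl hβ hγ T hT
    (stub_regularDLRUnique ω₂ lam β γ hω hl hβ hγ T hT) μT D hG hS hss hcar hP hAC
  have hmatch : ∀ ν : ℝ, 0 < ν → Tendsto (fun N : ℕ => F N ν / (N : ℝ)) atTop
      (𝓝 (∫ t in Ioi (0 : ℝ), Real.exp (-(ν * t)) * D.currentCorrelation μT t)) := fun ν hν => by
    simpa only [hF] using hmatch0 ν hν
  obtain ⟨R, hR⟩ : ∃ R : ℕ → ℝ → ℝ, R = fun (N : ℕ) (ν : ℝ) => ((N : ℝ) - 1) ^ 2 * T ^ 2 / F N ν := ⟨_, rfl⟩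
  have hqsr : ∀ ν : ℝ, 0 < ν → ν ≤ ν₂ → ∀ N : ℕ, N₂ ≤ N →
      2 * R N ν - C₂ * ((2 * N : ℕ) : ℝ) ^ θ₂ ≤ R (2 * N) ν := fun ν hν hν' N hN => by
    simpa only [hR, hF] using hqsr0 ν hν hν' N hN
  have hFpos : ∀ N : ℕ, 2 ≤ N → ∀ ν : ℝ, 0 < ν → 0 < F N ν := fun N hN ν hν => by
    simpa only [hF] using stub_resolventFormPos ω₂ lam β γ hω hl hβ hγ T hT N hN ν hν
  have hK' : ∀ N : ℕ, IntegrableOn (fun t : ℝ => ∫ z, (∑ i : Fin N, (Literature.MathematicalPhysics.KineticTheory.HeatConduction.pinnedChain ω₂ lam β γ).bondCurrent N i z) *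
        (∫ y, (∑ i : Fin N, (Literature.MathematicalPhysics.KineticTheory.HeatConduction.pinnedChain ω₂ lam β γ).bondCurrent N i y) ∂((Literature.MathematicalPhysics.KineticTheory.HeatConduction.pinnedChain ω₂ lam β γ).transitionKernel N T T t.toNNReal z))
        ∂((Literature.MathematicalPhysics.KineticTheory.HeatConduction.pinnedChain ω₂ lam β γ).gibbsMeasure N T)) (Ioi 0) ∧
      ((N : ℝ) - 1) * T ^ 2 * Dn N = ∫ t in Ioi (0 : ℝ), ∫ z, (∑ i : Fin N, (Literature.MathematicalPhysics.KineticTheory.HeatConduction.pinnedChain ω₂ lam β γ).bondCurrent N i z) *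
        (∫ y, (∑ i : Fin N, (Literature.MathematicalPhysics.KineticTheory.HeatConduction.pinnedChain ω₂ lam β γ).bondCurrent N i y) ∂((Literature.MathematicalPhysics.KineticTheory.HeatConduction.pinnedChain ω₂ lam β γ).transitionKernel N T T t.toNNReal z))
        ∂((Literature.MathematicalPhysics.KineticTheory.HeatConduction.pinnedChain ω₂ lam β γ).gibbsMeasure N T) :=
    fun N => StaticAbelianSqueeze.kuboAbelIdentity_holds
      ω₂ lam β γ hω hl hβ hγ hU μ hμ T hT N (Dn N) (hD N)
  have hDC : ∀ N : ℕ, Tendsto (F N) (𝓝[>] 0) (𝓝 (((N : ℝ) - 1) * T ^ 2 * Dn N)) := by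
    intro N
    rw [(hK' N).2]
    simpa only [hF] using tendsto_laplace_zero (hK' N).1
  have hDnonneg : ∀ N : ℕ, 0 ≤ Dn N := fun N =>
    Summit.AtomisticToContinuum.FouriersLaw.Theorems.response_nonneg_of_correctorTheory
      Summit.AtomisticToContinuum.FouriersLaw.Theorems.OddSectorIrreversibility.Corrector.CorrectorTheory_proof
      hω hl hβ hγ hU μ hμ hT N (hD N)
  set Ahat : ℝ → ℝ := fun ν => ∫ t in Ioi (0 : ℝ), Real.exp (-(ν * t)) * D.currentCorrelation μT t
    with hAhat
  have hT2 : (T ^ 2) ≠ 0 := by positivity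
  have hL : 0 < T ^ 2 * κ := by positivity
  have hA : Tendsto Ahat (𝓝[>] 0) (𝓝 (T ^ 2 * κ)) := by
    have h := hAbel.const_mul (T ^ 2)
    refine h.congr' (Eventually.of_forall fun ν => ?_)
    simp only [hAhat]
    rw [← mul_assoc, mul_inv_cancel₀ hT2, one_mul]
  set K₂ : ℝ := C₂ * ((2:ℝ) ^ (θ₂ - 1) / (1 - (2:ℝ) ^ (θ₂ - 1))) with hK₂
  have hK₂0 : 0 ≤ K₂ := mul_nonneg hC₂ (dyadic_const_pos hθ₂).le
  -- a frequency window on which `Â(ν) > T²κ/2 > 0`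
  obtain ⟨ν₄, hν₄, hAwin⟩ : ∃ ν₄ : ℝ, 0 < ν₄ ∧ ∀ ν ∈ Ioc (0:ℝ) ν₄, T ^ 2 * κ / 2 < Ahat ν := by
    have hev : ∀ᶠ ν in 𝓝[>] (0 : ℝ), T ^ 2 * κ / 2 < Ahat ν :=
      hA.eventually (lt_mem_nhds (by linarith))
    obtain ⟨u, hu, hsub⟩ := mem_nhdsGT_iff_exists_Ioc_subset.1 hev
    exact ⟨u, hu, fun ν hν => hsub hν⟩
  -- dyadic Fekete at fixed `ν` on the RESISTANCE form (QSR)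
  set ν₀ : ℝ := min ν₂ ν₄ with hν₀def
  have hν₀ : 0 < ν₀ := lt_min hν₂ hν₄
  have hρlim : ∀ ν ∈ Ioc (0 : ℝ) ν₀,
      Tendsto (fun N : ℕ => R N ν / N) atTop (𝓝 (T ^ 2 / Ahat ν)) := by
    intro ν hν
    have hν4 : ν ∈ Ioc (0:ℝ) ν₄ := ⟨hν.1, le_trans hν.2 (min_le_right _ _)⟩
    have hApos : 0 < Ahat ν := lt_trans (by positivity) (hAwin ν hν4)
    simpa only [hR] using tendsto_resistance_div (fun N => F N ν) T (Ahat ν) hApos.ne'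
      (by simpa only [hAhat] using hmatch ν hν.1)
  have hkey : ∀ ν ∈ Ioc (0 : ℝ) ν₀, ∀ N : ℕ, N₀ ≤ N →
      R N ν ≤ N * (T ^ 2 / Ahat ν) + K₂ * (N : ℝ) ^ θ₂ :=
    fun ν hν N hN => stub_dyadicFeketePow (fun M => R M ν) (T ^ 2 / Ahat ν) C₂ θ₂ N₀ hN₀1
      hC₂ hθ₂ (fun M hM => hqsr ν hν.1 (le_trans hν.2 (min_le_left _ _)) M (le_trans hN₂le hM))
      (hρlim ν hν) N hN
  -- `ν ↓ 0` at fixed `N`; positivity of `D_N` is forced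
  have hρ0 : Tendsto (fun ν => T ^ 2 / Ahat ν) (𝓝[>] 0) (𝓝 (T ^ 2 / (T ^ 2 * κ))) :=
    tendsto_const_nhds.div hA hL.ne'
  have hTκ : T ^ 2 / (T ^ 2 * κ) = κ⁻¹ := by
    field_simp
  have hlowpos : ∀ N : ℕ, N₀ ≤ N → 0 < Dn N ∧ ((N : ℝ) - 1) / Dn N ≤ N * κ⁻¹ + K₂ * (N : ℝ) ^ θ₂ := by
    intro N hN
    have hN2' : 2 ≤ N := le_trans hN₀2 hN
    have hN2 : (2 : ℝ) ≤ N := by exact_mod_cast hN2'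
    have hN1 : (0 : ℝ) < (N : ℝ) - 1 := by linarith
    have ha : 0 < ((N : ℝ) - 1) ^ 2 * T ^ 2 := by positivity
    have hb : Tendsto (fun ν => (N : ℝ) * (T ^ 2 / Ahat ν) + K₂ * (N : ℝ) ^ θ₂) (𝓝[>] 0)
        (𝓝 ((N : ℝ) * κ⁻¹ + K₂ * (N : ℝ) ^ θ₂)) := by
      have := (hρ0.const_mul (N : ℝ)).add_const (K₂ * (N : ℝ) ^ θ₂)
      rwa [hTκ] at this
    have hF0 : 0 ≤ ((N : ℝ) - 1) * T ^ 2 * Dn N := by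
      have := hDnonneg N
      positivity
    obtain ⟨hF0pos, hle⟩ := dc_of_resistance_bound (F N)
      (fun ν => (N : ℝ) * (T ^ 2 / Ahat ν) + K₂ * (N : ℝ) ^ θ₂) (((N : ℝ) - 1) ^ 2 * T ^ 2)
      (((N : ℝ) - 1) * T ^ 2 * Dn N) ((N : ℝ) * κ⁻¹ + K₂ * (N : ℝ) ^ θ₂) ν₀ ha hν₀
      (fun ν hν => hFpos N hN2' ν hν.1) (hDC N) hF0 (fun ν hν => by simpa only [hR] using hkey ν hν N hN) hb
    have hDpos : 0 < Dn N := by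
      refine lt_of_not_ge fun hcon => ?_
      have h1 : ((N : ℝ) - 1) * T ^ 2 * Dn N ≤ 0 :=
        mul_nonpos_of_nonneg_of_nonpos (by positivity) hcon
      linarith
    refine ⟨hDpos, ?_⟩
    have e : ((N : ℝ) - 1) ^ 2 * T ^ 2 / (((N : ℝ) - 1) * T ^ 2 * Dn N) = ((N : ℝ) - 1) / Dn N := by
      field_simp
    rwa [e] at hle
  -- the lower envelope `κ(N−1)/(N + κK₂N^θ₂) ≤ Dn N`, and it tends to `κ`
  have hlo := conductance_lower_of_resistance' Dn
    (fun N => K₂ * (N : ℝ) ^ θ₂) κ N₀ hN₀2 hκ (fun N => mul_nonneg hK₂0 (Real.rpow_nonneg (Nat.cast_nonneg N) θ₂))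
    (fun N hN => (hlowpos N hN).1) (fun N hN => (hlowpos N hN).2)
  have henv := tendsto_lower_envelope' κ
    (fun N => K₂ * (N : ℝ) ^ θ₂)
    (tendsto_const_mul_rpow_div K₂ θ₂ hθ₂)
  intro ε hε
  have hev : ∀ᶠ N : ℕ in atTop, κ - ε < κ * (((N : ℝ) - 1) / ((N : ℝ) + κ * (K₂ * (N : ℝ) ^ θ₂))) :=
    henv (Ioi_mem_nhds (by linarith))
  obtain ⟨N₄, hN₄⟩ := (hev.and (eventually_ge_atTop N₀)).exists_forall_of_atTop
  refine ⟨N₄, fun N hN => ?_⟩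
  obtain ⟨hlt, hN0⟩ := hN₄ N hN
  exact ⟨(hlowpos N hN0).1, (hlt.le.trans (hlo N hN0))⟩


/-- **Registered stub `stub_noDeficitOfQSR`** — `noDeficit_of_quasiSuperadditiveResistance` in binder-free form: regular
witness + QSR at the parameter point ⇒ eventually `0 < Dn N ∧ κ − ε ≤ Dn N`. [folklore] -/
theorem stub_noDeficitOfQSR :
    ∀ ω₂ lam β γ : ℝ, 0 < ω₂ → 0 < lam → 0 < β → 0 < γ →
      (∀ (N : ℕ) (T_L T_R : ℝ), 0 < T_L → 0 < T_R → ∀ μ ν : MeasureTheory.Measure (Literature.MathematicalPhysics.KineticTheory.HeatConduction.PhaseSpace N),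
        (Literature.MathematicalPhysics.KineticTheory.HeatConduction.pinnedChain ω₂ lam β γ).IsSteadyState N T_L T_R μ → (Literature.MathematicalPhysics.KineticTheory.HeatConduction.pinnedChain ω₂ lam β γ).IsSteadyState N T_L T_R ν → μ = ν) →
      ∀ T : ℝ, 0 < T →
      ∀ (μT : MeasureTheory.Measure Literature.MathematicalPhysics.KineticTheory.HeatConduction.ChainConfig)
        (D : Literature.MathematicalPhysics.KineticTheory.HeatConduction.InfiniteChainDynamics (Literature.MathematicalPhysics.KineticTheory.HeatConduction.pinnedChain ω₂ lam β γ)) (κ : ℝ),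
        (Literature.MathematicalPhysics.KineticTheory.HeatConduction.pinnedChain ω₂ lam β γ).IsChainGibbsMeasure T μT → Literature.MathematicalPhysics.KineticTheory.HeatConduction.IsShiftInvariant μT →
        (Literature.MathematicalPhysics.KineticTheory.HeatConduction.pinnedChain ω₂ lam β γ).HasSuperstabilityEstimate μT → D.carrier ⊆ (Literature.MathematicalPhysics.KineticTheory.HeatConduction.pinnedChain ω₂ lam β γ).bmGood → D.PreservesMeasure μT →
        (∀ t : ℝ, D.HasAbsConvergentCorrelation μT t) → 0 < κ →
        Filter.Tendsto (fun ν : ℝ => (T ^ 2)⁻¹ *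
          MeasureTheory.integral (MeasureTheory.volume.restrict (Set.Ioi (0:ℝ)))
            (fun t : ℝ => Real.exp (-(ν * t)) * D.currentCorrelation μT t)) (nhdsWithin (0:ℝ) (Set.Ioi 0)) (nhds κ) →
        (let F : ℕ → ℝ → ℝ := fun (N : ℕ) (ν : ℝ) =>
        MeasureTheory.integral (MeasureTheory.volume.restrict (Set.Ioi (0:ℝ))) (fun t : ℝ =>
          Real.exp (-(ν * t)) *
            ∫ z, (∑ i : Fin N, (Literature.MathematicalPhysics.KineticTheory.HeatConduction.pinnedChain ω₂ lam β γ).bondCurrent N i z) *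
              (∫ y, (∑ i : Fin N, (Literature.MathematicalPhysics.KineticTheory.HeatConduction.pinnedChain ω₂ lam β γ).bondCurrent N i y) ∂((Literature.MathematicalPhysics.KineticTheory.HeatConduction.pinnedChain ω₂ lam β γ).transitionKernel N T T t.toNNReal z))
              ∂((Literature.MathematicalPhysics.KineticTheory.HeatConduction.pinnedChain ω₂ lam β γ).gibbsMeasure N T));
         let R : ℕ → ℝ → ℝ := fun N ν => ((N : ℝ) - 1) ^ 2 * T ^ 2 / F N ν;
         ∃ C θ ν₀ : ℝ, ∃ N₀ : ℕ, 0 ≤ C ∧ θ < 1 ∧ 0 < ν₀ ∧ ∀ ν : ℝ, 0 < ν → ν ≤ ν₀ → ∀ N : ℕ, N₀ ≤ N →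
           2 * R N ν - C * ((2 * N : ℕ) : ℝ) ^ θ ≤ R (2 * N) ν) →
        ∀ μ : (N : ℕ) → ℝ → ℝ → MeasureTheory.Measure (Literature.MathematicalPhysics.KineticTheory.HeatConduction.PhaseSpace N),
          (∀ (N : ℕ) (T_L T_R : ℝ), 0 < T_L → 0 < T_R → (Literature.MathematicalPhysics.KineticTheory.HeatConduction.pinnedChain ω₂ lam β γ).IsSteadyState N T_L T_R (μ N T_L T_R)) →
          ∀ Dn : ℕ → ℝ,
            (∀ N : ℕ, Filter.Tendsto (fun δ : ℝ => (Literature.MathematicalPhysics.KineticTheory.HeatConduction.pinnedChain ω₂ lam β γ).totalCurrent (μ N (T + δ / 2) (T - δ / 2)) / δ)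
              (nhdsWithin 0 {(0 : ℝ)}ᶜ) (nhds (Dn N))) →
            ∀ ε : ℝ, 0 < ε → ∃ N₃ : ℕ, ∀ N : ℕ, N₃ ≤ N → 0 < Dn N ∧ κ - ε ≤ Dn N :=
  fun _ _ _ _ hω hl hβ hγ hU _ hT _ _ _ hG hS hss hcar hP hAC hκ hAbel hQSR μ hμ Dn hD =>
    noDeficit_of_quasiSuperadditiveResistance hω hl hβ hγ hU hT hG hS hss hcar hP hAC hκ hAbel hQSR μ hμ Dn hD

end Summit.AtomisticToContinuum.FouriersLaw.Theorems.AbelThermodynamicLimit.SeriesLawAtEveryLaplaceFrequency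

end
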